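import Literature.IUT.HodgeTheaters.PuncturedEllipticCoveringsCor12IotaLawOfLaws
import Literature.IUT.HodgeTheaters.PuncturedEllipticCoveringsArrowClaimsOfModLCuspLaws
import Literature.AnabelianGeometry.AbsoluteAnabelian.FreeProSigmaTorsionFree
import Literature.AnabelianGeometry.AbsoluteAnabelian.ProfiniteTFGAscent
import Mathlib.GroupTheory.NoncommPiCoprod
import HarnessLib

/-!
# [IUTchI] Cor. 1.2 at the genuine `K`-level datum: the laws `hrank′`, `hΔ`, `hΔ′` (and print's "torsion-free")
# from ONE classical input — `Δ_X` free profinite on two generators — proof-only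

Mochizuki, *Inter-universal Teichmüller theory I*, kurims manuscript (May 2020), §1, pp. 37–39: assumption (∗)
"the natural action of `G_k` on `Δ_X^{ab} ⊗ (ℤ/lℤ)` is trivial" (p. 37 l. 42–44) and the proof of Corollary 1.2
p. 39 l. 21–33 ("`H := Ker(Δ_X ↠ Δ_X^{ab} ⊗ ℤ/lℤ)`", "`Π_X̲ = Π_{X̲→}·H`") [cite: Mochizuki2012, IUTchI Cor 1.2 p.39]
(D-0012 claim key; series status DISPUTED — nothing of the series is asserted; PROVED are statements about the
tree's own objects).  Classical input: for the once-punctured elliptic curve `X_K = E_K ∖ {O}` over `K̄`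
(characteristic `0`), `Δ_X ≅ F̂₂` is free profinite on two generators [SGA1 XIII Cor. 2.12 + comparison], in the
tree's vocabulary of [AbsTopI] Lemma 4.5 (i) p. 54: `IsFreeProOn Δ_X Set.univ gens`, `gens : Fin 2 → Δ_X`
(abc-iut-L4 `AbsTopISemiAbsolute.lean`; FACT-LIST F-0241/F-0242 vocabulary) [cite: MochizukiAbsTopI2012, Lemma 4.5 (i) p.54].

PROOF-ONLY file (cell abc-iut, seat abc-iut-L5-t1 gen 11, row «COR12-OF-FREEPRO» = §R R1 of the HUB census
`HOME/staging/L5/L5-t1/g11/SUBDAG-IUTchI-Cor12.md`).  The certificate conjunct of record for the cone node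
`IUTchI:Cor1.2`, `Summit.ABC.IUTFork.Conditional.layer5_held_cor12_v6` (over abc-iut-L5-d4's closer
`InitialThetaData.pe_characteristicNatureOfCoverings_viaX_of_laws`, p448270), displays 14 LAW binders at the
GENUINE `K`-level data `D.geom.pe`; eight are classical structure laws of the étale fundamental group of `X_K` that
the INTERFACE `PuncturedEllipticData` (abc-iut-L5-t1, p404449) does not carry.  Here ONE instance-shaped classical
input — `Δ_X` free profinite of rank `2` — yields three of them BY NAME over abc-iut-L4's free-pro-`Σ` toolkit:
* `IsFreeProOn.index_modPowCommutatorClosure_eq` — GENERIC: for `G` profinite, free profinite on `gens : Fin n → G`,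
  and `1 < l`, the closed subgroup `(⁅G,G⁆·G^l)⁻` has index `l ^ n` (`≥`: universal property at `(ℤ/l)ⁿ`; `≤`:
  density of `⟨gens⟩`, `IsFreeProOn.dense_range_lift`, and finiteness of the image of `(ℤ/l)ⁿ → G/Φ`);
  `relIndex_modPowCommutatorClosure_eq_of_isFreeProOn` — the same for a CLOSED subgroup `Δ ≤ P`, `relIndex` form;
* `PuncturedEllipticData.relIndex_H_eq_sq_of_isFreeProOn` — **`[Δ_X : H] = l²`**, EXACTLY the binder `hrank′`;
* `PuncturedEllipticData.geomTFG_of_isFreeProOn` — **`GeomTFG` of the `k`-core** ([AbsTopI] Prop. 2.2 at the core,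
  FACT-LIST F-0240 = binders `hΔ`, `hΔ′`) DERIVED (`IsFreeProOn.isTopologicallyFinitelyGenerated` + `Δ_X` open in
  `Δ_C` + abc-iut-L4's `FundamentalExtension.geomTFG_of_isOpen_subgroup`);
* `PuncturedEllipticData.torsionFree_deltaX_of_isFreeProOn` — print's "`Δ_X` torsion-free" ([AbsTopI] Lem. 4.1
  (iv)) in the `IsOfFinOrder` form.  TYPING NOTE: the binder `htf` of p448270 is Mathlib's `IsMulTorsionFree`
  («`x ↦ xⁿ` injective»), a priori STRONGER for a non-commutative group; it is NOT discharged here;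
* `InitialThetaData.pe_characteristicNatureOfCoverings_viaX_of_freePro` — the closer p448270 with `hrank′`
  DISCHARGED and `hΔ`, `hΔ′` DERIVED from two displayed instance-shaped binders `hfree`, `hfree′`; all other binders
  as there: LAW count 14 → 13, the two F-0240 instances replaced by two F-0242-shaped ones.

HONEST FRAMING: classical profinite group theory over the tree's interfaces; binders are assumption labels (nothing
asserts that `Δ_X` of a given datum IS free — that is the origin/FACT-instance object (A) of the census); typed ≠
discharged for the anabelian inputs; nothing here bears on [IUTchIII] Cor. 3.12 or asserts that abc is proved or
refuted.  No `def`, no instance, no new `Prop` fact; axioms standard.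
-/

noncomputable section

open Topology

namespace Literature.AnabelianGeometry.AbsoluteAnabelian

universe u

/-! ### §1. GENERIC: the index of `(⁅G,G⁆ · G^l)⁻` in a free profinite group of rank `n` is `l ^ n` -/

section Generic

variable {G : Type u} [Group G] [TopologicalSpace G] [IsTopologicalGroup G] [CompactSpace G]
  [T2Space G] [TotallyDisconnectedSpace G]
variable {n : ℕ} {gens : Fin n → G}

omit [TopologicalSpace G] [IsTopologicalGroup G] [CompactSpace G] [T2Space G] [TotallyDisconnectedSpace G] in
/-- Any subgroup containing the commutator subgroup `⁅G, G⁆` is normal. [folklore] -/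
private theorem normal_of_commutator_le (Φ : Subgroup G) (h : ⁅(⊤ : Subgroup G), ⊤⁆ ≤ Φ) : Φ.Normal := by
  refine ⟨fun x hx g => ?_⟩
  have hc : g * x * g⁻¹ * x⁻¹ ∈ Φ := by
    have := Subgroup.commutator_mem_commutator (Subgroup.mem_top g) (Subgroup.mem_top x)
      (H₁ := (⊤ : Subgroup G)) (H₂ := ⊤)
    rw [commutatorElement_def] at this
    exact h this
  have := Φ.mul_mem hc hx
  rwa [inv_mul_cancel_right] at this

/-- **The maximal elementary-abelian-`l` quotient of a free profinite group of rank `n` has order `l ^ n`**: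
if the profinite group `G` is free profinite on `gens : Fin n → G` (`IsFreeProOn G Set.univ gens`, [AbsTopI]
Lem. 4.5 (i) vocabulary) and `1 < l`, then the closure `Φ` of `⁅G,G⁆ · ⟨g^l : g ∈ G⟩` has index `l ^ n`.
Lower bound: the universal property gives a continuous `φ : G → (ℤ/l)ⁿ` with `gensᵢ ↦ eᵢ`, which kills `Φ`.
Upper bound: in `G/Φ` (abelian, exponent `l`) the images of the `gens` generate a subgroup that is the range
of a homomorphism from the finite group `(ℤ/l)ⁿ`; its preimage in `G` is a finite union of cosets of the
closed `Φ`, hence closed, and contains the dense subgroup `⟨gens⟩` (`IsFreeProOn.dense_range_lift`), so it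
is everything; composing, `G/Φ ≅ (ℤ/l)ⁿ`. [cite: MochizukiAbsTopI2012, Lemma 4.5 (i) p.54] -/
theorem IsFreeProOn.index_modPowCommutatorClosure_eq (h : IsFreeProOn G Set.univ gens) (l : ℕ)
    [hl : Fact (1 < l)] :
    ((⁅(⊤ : Subgroup G), ⊤⁆ ⊔
        Subgroup.closure ((fun y : G => y ^ l) '' Set.univ)).topologicalClosure).index = l ^ n := by
  classical
  haveI : NeZero l := ⟨by have := hl.out; omega⟩
  set Φ : Subgroup G := (⁅(⊤ : Subgroup G), ⊤⁆ ⊔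
    Subgroup.closure ((fun y : G => y ^ l) '' Set.univ)).topologicalClosure with hΦdef
  have hcomm_le : ⁅(⊤ : Subgroup G), ⊤⁆ ≤ Φ := le_sup_left.trans (Subgroup.le_topologicalClosure _)
  have hpow_mem : ∀ y : G, y ^ l ∈ Φ := fun y => Subgroup.le_topologicalClosure _
    (Subgroup.mem_sup_right (Subgroup.subset_closure ⟨y, Set.mem_univ _, rfl⟩))
  have hΦc : IsClosed (Φ : Set G) := Subgroup.isClosed_topologicalClosure _
  haveI hΦN : Φ.Normal := normal_of_commutator_le Φ hcomm_le
  let π : G →* G ⧸ Φ := QuotientGroup.mk' Φ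
  have hπs : Function.Surjective π := QuotientGroup.mk'_surjective Φ
  have hQcomm : ∀ a b : G ⧸ Φ, Commute a b := by
    intro a b
    obtain ⟨x, rfl⟩ := hπs a
    obtain ⟨y, rfl⟩ := hπs b
    change π x * π y = π y * π x
    rw [← map_mul, ← map_mul, QuotientGroup.mk'_apply, QuotientGroup.mk'_apply, QuotientGroup.eq]
    have hmem : y⁻¹ * x⁻¹ * y⁻¹⁻¹ * x⁻¹⁻¹ ∈ Φ := by
      have := Subgroup.commutator_mem_commutator (Subgroup.mem_top y⁻¹) (Subgroup.mem_top x⁻¹)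
        (H₁ := (⊤ : Subgroup G)) (H₂ := ⊤)
      rw [commutatorElement_def] at this
      exact hcomm_le this
    have hxy : (x * y)⁻¹ * (y * x) = y⁻¹ * x⁻¹ * y⁻¹⁻¹ * x⁻¹⁻¹ := by group
    rw [hxy]
    exact hmem
  have hQpow : ∀ a : G ⧸ Φ, a ^ l = 1 := by
    intro a
    obtain ⟨x, rfl⟩ := hπs a
    rw [← map_pow, QuotientGroup.mk'_apply, QuotientGroup.eq_one_iff]
    exact hpow_mem x
  let K : Type := Fin n → Multiplicative (ZMod l)
  have hKpow : ∀ k : K, k ^ l = 1 := by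
    intro k
    funext i
    change (k i) ^ l = 1
    rw [← ofAdd_toAdd (k i), ← ofAdd_nsmul, nsmul_eq_mul, ZMod.natCast_self, zero_mul, ofAdd_zero]
  obtain ⟨φ, ⟨hφc, hφgens⟩, -⟩ :=
    h.2 K (fun _ _ _ => Set.mem_univ _) fun i => Pi.mulSingle i (Multiplicative.ofAdd (1 : ZMod l))
  have hkerc : IsClosed (φ.ker : Set G) := by
    rw [MonoidHom.coe_ker]
    exact isClosed_singleton.preimage hφc
  have hΦker : Φ ≤ φ.ker := by
    refine Subgroup.topologicalClosure_minimal _ (sup_le ?_ ?_) hkerc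
    · rw [Subgroup.commutator_le]
      intro a _ b _
      rw [MonoidHom.mem_ker, map_commutatorElement, commutatorElement_eq_one_iff_commute]
      exact Commute.all _ _
    · rw [Subgroup.closure_le]
      rintro _ ⟨y, -, rfl⟩
      change φ (y ^ l) = 1
      rw [map_pow, hKpow]
  let φbar : G ⧸ Φ →* K := QuotientGroup.lift Φ φ hΦker
  have hφbar : ∀ x : G, φbar (π x) = φ x := fun x => QuotientGroup.lift_mk' Φ hΦker x
  let e : Fin n → {f : ℤ →+ Additive (G ⧸ Φ) // f l = 0} := fun i =>
    ⟨zmultiplesHom (Additive (G ⧸ Φ)) (Additive.ofMul (π (gens i))), by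
      change ((l : ℤ)) • Additive.ofMul (π (gens i)) = 0
      rw [natCast_zsmul, ← ofMul_pow, hQpow, ofMul_one]⟩
  let ϕ : ∀ i : Fin n, Multiplicative (ZMod l) →* G ⧸ Φ := fun i =>
    AddMonoidHom.toMultiplicativeLeft (ZMod.lift l (e i))
  have hϕ : ∀ (i : Fin n) (z : ℤ), ϕ i (Multiplicative.ofAdd (z : ZMod l)) = π (gens i) ^ z := by
    intro i z
    change Additive.toMul ((ZMod.lift l (e i)) (Multiplicative.toAdd (Multiplicative.ofAdd (z : ZMod l))))
      = _
    rw [toAdd_ofAdd, ZMod.lift_coe]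
    change Additive.toMul (z • Additive.ofMul (π (gens i))) = _
    rw [← ofMul_zpow, toMul_ofMul]
  have hϕ' : ∀ (i : Fin n) (x : Multiplicative (ZMod l)),
      ϕ i x = π (gens i) ^ ((Multiplicative.toAdd x).cast : ℤ) := by
    intro i x
    conv_lhs => rw [← ofAdd_toAdd x, ← ZMod.intCast_zmod_cast (Multiplicative.toAdd x)]
    exact hϕ i _
  have hcommϕ : Pairwise fun i j => ∀ x y, Commute (ϕ i x) (ϕ j y) := fun _ _ _ _ _ => hQcomm _ _
  let ψ : K →* G ⧸ Φ := MonoidHom.noncommPiCoprod ϕ hcommϕ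
  have hψ_single : ∀ (i : Fin n) (x : Multiplicative (ZMod l)), ψ (Pi.mulSingle i x) = ϕ i x :=
    fun i x => MonoidHom.noncommPiCoprod_mulSingle ϕ i x
  have hφψ : φbar.comp ψ = MonoidHom.id K := by
    refine MonoidHom.functions_ext _ _ _ fun i x => ?_
    rw [MonoidHom.comp_apply, MonoidHom.id_apply, hψ_single, hϕ', map_zpow, hφbar, hφgens,
      ← Pi.mulSingle_zpow, ← ofAdd_zsmul, zsmul_eq_mul, mul_one, ZMod.intCast_zmod_cast, ofAdd_toAdd]
  have hφψ' : ∀ k : K, φbar (ψ k) = k := fun k => by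
    have := congrArg (fun f : K →* K => f k) hφψ
    simpa using this
  have hψs : Function.Surjective ψ := by
    let B : Subgroup G := ψ.range.comap π
    have hfin : (ψ.range : Set (G ⧸ Φ)).Finite := by
      have : (ψ.range : Set (G ⧸ Φ)) = Set.range ψ := MonoidHom.coe_range ψ
      rw [this]
      exact Set.finite_range ψ
    have hfibre : ∀ a : G ⧸ Φ, IsClosed (π ⁻¹' {a}) := by
      intro a
      obtain ⟨g, rfl⟩ := hπs a
      have hset : π ⁻¹' {π g} = (fun x : G => x⁻¹ * g) ⁻¹' (Φ : Set G) := by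
        ext x
        simp only [Set.mem_preimage, Set.mem_singleton_iff, SetLike.mem_coe]
        change ((x : G ⧸ Φ) = (g : G ⧸ Φ)) ↔ _
        exact QuotientGroup.eq
      rw [hset]
      exact hΦc.preimage (continuous_inv.mul continuous_const)
    have hBc : IsClosed (B : Set G) := by
      have hB : (B : Set G) = π ⁻¹' (ψ.range : Set (G ⧸ Φ)) := rfl
      rw [hB, ← Set.biUnion_preimage_singleton]
      exact hfin.isClosed_biUnion fun a _ => hfibre a
    have hgensB : ∀ i, gens i ∈ B := by
      intro i
      change π (gens i) ∈ ψ.range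
      refine ⟨Pi.mulSingle i (Multiplicative.ofAdd ((1 : ℤ) : ZMod l)), ?_⟩
      rw [hψ_single, hϕ, zpow_one]
    have hBtop : B = ⊤ := by
      have hcl : Subgroup.closure (Set.range gens) ≤ B := by
        rw [Subgroup.closure_le]
        rintro _ ⟨i, rfl⟩
        exact hgensB i
      have htc : (Subgroup.closure (Set.range gens)).topologicalClosure = ⊤ := by
        apply SetLike.coe_injective
        rw [Subgroup.topologicalClosure_coe, Subgroup.coe_top, ← FreeGroup.range_lift_eq_closure,
          MonoidHom.coe_range]
        exact h.dense_range_lift.closure_eq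
      rw [eq_top_iff, ← htc]
      exact Subgroup.topologicalClosure_minimal _ hcl hBc
    intro a
    obtain ⟨x, rfl⟩ := hπs a
    have hx : x ∈ B := by rw [hBtop]; exact Subgroup.mem_top x
    exact hx
  have hkerΦ : φ.ker = Φ := by
    refine le_antisymm (fun x hx => ?_) hΦker
    obtain ⟨k, hk⟩ := hψs (π x)
    have h1 : k = 1 := by rw [← hφψ' k, hk, hφbar]; exact hx
    rw [h1, map_one] at hk
    exact (QuotientGroup.eq_one_iff x).mp hk.symm
  have hφs : Function.Surjective φ := by
    intro k
    obtain ⟨x, hx⟩ := hπs (ψ k)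
    exact ⟨x, by rw [← hφbar, hx, hφψ']⟩
  rw [← hkerΦ, Subgroup.index_ker, MonoidHom.range_eq_top.mpr hφs, Subgroup.card_top, Nat.card_pi]
  simp only [Finset.prod_const, Finset.card_univ, Fintype.card_fin]
  change Nat.card (ZMod l) ^ n = l ^ n
  rw [Nat.card_zmod]

/-- **The same in the `Subgroup.relIndex` currency for a CLOSED subgroup `Δ` of a profinite group `P`**: if
`↥Δ` is free profinite on `gens : Fin n → Δ` and `1 < l`, then the closure (in `P`) of
`⁅Δ,Δ⁆ · ⟨y^l : y ∈ Δ⟩` has relative index `l ^ n` in `Δ`. [cite: MochizukiAbsTopI2012, Lemma 4.5 (i) p.54] -/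
theorem relIndex_modPowCommutatorClosure_eq_of_isFreeProOn {P : Type u} [Group P] [TopologicalSpace P]
    [IsTopologicalGroup P] [CompactSpace P] [T2Space P] [TotallyDisconnectedSpace P]
    (Δ : Subgroup P) (hΔ : IsClosed (Δ : Set P)) {n : ℕ} {gens : Fin n → Δ}
    (h : IsFreeProOn Δ Set.univ gens) (l : ℕ) [Fact (1 < l)] :
    ((⁅Δ, Δ⁆ ⊔ Subgroup.closure ((fun y : P => y ^ l) '' (Δ : Set P))).topologicalClosure).relIndex Δ
      = l ^ n := by
  haveI : CompactSpace Δ := isCompact_iff_compactSpace.mp hΔ.isCompact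
  have hemb : Topology.IsClosedEmbedding ((↑) : Δ → P) := hΔ.isClosedEmbedding_subtypeVal
  set Φ₀ : Subgroup Δ := (⁅(⊤ : Subgroup Δ), ⊤⁆ ⊔
    Subgroup.closure ((fun y : Δ => y ^ l) '' Set.univ)).topologicalClosure with hΦ₀
  have hmap : Φ₀.map Δ.subtype =
      (⁅Δ, Δ⁆ ⊔ Subgroup.closure ((fun y : P => y ^ l) '' (Δ : Set P))).topologicalClosure := by
    have hset : (Δ.subtype : Δ → P) '' ((fun y : Δ => y ^ l) '' Set.univ) =
        (fun y : P => y ^ l) '' (Δ : Set P) := by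
      ext z
      constructor
      · rintro ⟨_, ⟨y, -, rfl⟩, rfl⟩
        exact ⟨y, y.2, by rw [Subgroup.coe_subtype, Subgroup.coe_pow]⟩
      · rintro ⟨y, hy, rfl⟩
        exact ⟨⟨y, hy⟩ ^ l, ⟨⟨y, hy⟩, Set.mem_univ _, rfl⟩, by rw [Subgroup.coe_subtype, Subgroup.coe_pow]⟩
    apply SetLike.coe_injective
    rw [Subgroup.coe_map, hΦ₀, Subgroup.topologicalClosure_coe, Subgroup.topologicalClosure_coe,
      Subgroup.coe_subtype, ← hemb.closure_image_eq, ← Subgroup.coe_subtype, ← Subgroup.coe_map,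
      Subgroup.map_sup, Subgroup.map_commutator, ← MonoidHom.range_eq_map, Subgroup.range_subtype,
      MonoidHom.map_closure, hset]
  rw [← hmap]
  change ((Φ₀.map Δ.subtype).comap Δ.subtype).index = l ^ n
  rw [Subgroup.comap_map_eq_self_of_injective Δ.subtype_injective]
  exact h.index_modPowCommutatorClosure_eq l

end Generic

end Literature.AnabelianGeometry.AbsoluteAnabelian

/-! ### §2. At a `PuncturedEllipticData`: `hrank′`, `GeomTFG`, torsion-freeness from `Δ_X` free of rank 2 -/

namespace Literature.IUT.HodgeTheaters

namespace PuncturedEllipticData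

open Literature.AnabelianGeometry.AbsoluteAnabelian

universe u

variable (D : PuncturedEllipticData.{u})

/-- `Δ_X = Π_X ∩ Δ_C` is closed in `Π_C` (`Π_X` open, `Δ_C` a kernel). ([IUTchI] §1 p.37)
[claim: Mochizuki2012, status: disputed] -/
theorem isClosed_piX_inf_deltaC : IsClosed ((D.PiX ⊓ D.DeltaC : Subgroup D.PiC) : Set D.PiC) := by
  rw [Subgroup.coe_inf]
  exact (D.PiX.isClosed_of_isOpen D.isOpen_piX).inter D.E.isClosed_geom

/-- **The law `hrank` — `[Δ_X : H] = l²` for `H = Ker(Δ_X ↠ Δ_X^{ab} ⊗ ℤ/lℤ)` — from `Δ_X` free profinite on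
two generators** ("`Δ_X^{ab} ⊗ (ℤ/lℤ)`" of (∗), p. 37, is `E[l] ≅ (ℤ/lℤ)²`): EXACTLY the hypothesis `hrank` of
abc-iut-L5-d4's `CuspGalois.not_deltaXbar_le_H_of_relIndex` / `hrank′` of the closer p448270.
([IUTchI] §1 p.37, Cor 1.2 p.39) [claim: Mochizuki2012, status: disputed] -/
theorem relIndex_H_eq_sq_of_isFreeProOn {gens : Fin 2 → ↥(D.PiX ⊓ D.DeltaC)}
    (hfree : IsFreeProOn ↥(D.PiX ⊓ D.DeltaC) Set.univ gens) :
    (⁅D.PiX ⊓ D.DeltaC, D.PiX ⊓ D.DeltaC⁆ ⊔ Subgroup.closure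
      ((fun y : D.PiC => y ^ D.l) '' (D.PiX ⊓ D.DeltaC : Set D.PiC))).topologicalClosure.relIndex
        (D.PiX ⊓ D.DeltaC) = D.l ^ 2 :=
  haveI : Fact (1 < D.l) := ⟨by have := D.five_le; omega⟩
  relIndex_modPowCommutatorClosure_eq_of_isFreeProOn (D.PiX ⊓ D.DeltaC) D.isClosed_piX_inf_deltaC hfree D.l

/-- **`GeomTFG` of the `k`-core `Π_C ↠ G_k`** ([AbsTopI] Prop. 2.2 AT the core, FACT-LIST F-0240 — the binders
`hΔ`, `hΔ′` of the Cor. 1.2 closers) **DERIVED from `Δ_X` free profinite of finite rank**: `Δ_X` is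
topologically finitely generated (`IsFreeProOn.isTopologicallyFinitelyGenerated`) and OPEN in `Δ_C`
(`= Δ_C ∩ Π_X`), so abc-iut-L4's ascent `FundamentalExtension.geomTFG_of_isOpen_subgroup` applies.
([IUTchI] Cor 1.2 p.39) [claim: Mochizuki2012, status: disputed] -/
theorem geomTFG_of_isFreeProOn {n : ℕ} {gens : Fin n → ↥(D.PiX ⊓ D.DeltaC)}
    (hfree : IsFreeProOn ↥(D.PiX ⊓ D.DeltaC) Set.univ gens) : D.E.GeomTFG := by
  haveI : CompactSpace ↥(D.PiX ⊓ D.DeltaC) :=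
    isCompact_iff_compactSpace.mp D.isClosed_piX_inf_deltaC.isCompact
  let U : Subgroup D.E.geom := (D.PiX ⊓ D.DeltaC).subgroupOf D.E.geom
  have hUo : IsOpen (U : Set D.E.geom) := by
    have hU : (U : Set D.E.geom) = Subtype.val ⁻¹' (D.PiX : Set D.PiC) := by
      ext x
      change (x : D.PiC) ∈ D.PiX ⊓ D.DeltaC ↔ (x : D.PiC) ∈ D.PiX
      rw [Subgroup.mem_inf]
      exact ⟨fun h => h.1, fun h => ⟨h, x.2⟩⟩
    rw [hU]
    exact D.isOpen_piX.preimage continuous_subtype_val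
  let f : ↥(D.PiX ⊓ D.DeltaC) →ₜ* U :=
    { toFun := fun x => ⟨⟨(x : D.PiC), (Subgroup.mem_inf.mp x.2).2⟩,
        show ((⟨(x : D.PiC), (Subgroup.mem_inf.mp x.2).2⟩ : D.E.geom) : D.PiC) ∈ D.PiX ⊓ D.DeltaC from x.2⟩
      map_one' := Subtype.ext (Subtype.ext rfl)
      map_mul' := fun _ _ => Subtype.ext (Subtype.ext rfl)
      continuous_toFun := (continuous_subtype_val.subtype_mk _).subtype_mk _ }
  have hf : Function.Surjective f := by
    rintro ⟨⟨x, hxC⟩, hxU⟩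
    exact ⟨⟨x, hxU⟩, rfl⟩
  exact D.E.geomTFG_of_isOpen_subgroup U hUo
    (IsTopologicallyFinitelyGenerated.of_surjective f hf hfree.isTopologicallyFinitelyGenerated)

/-- **Print's "`Δ_X` is torsion-free"** ([AbsTopI] Lem. 4.1 (iv): `X` a scheme) in the `IsOfFinOrder` form, from
`Δ_X` free profinite of finite rank (abc-iut-L4's `IsFreeProOn.torsionFree`).  TYPING NOTE: the binder `htf` of
the Cor. 1.2 closers is Mathlib's `IsMulTorsionFree ↥(Π_X ⊓ Δ_C)` («`x ↦ xⁿ` injective»), a priori STRONGER for a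
non-commutative group; it is not claimed here. ([IUTchI] Cor 1.2 p.39) [claim: Mochizuki2012, status: disputed] -/
theorem torsionFree_deltaX_of_isFreeProOn {n : ℕ} {gens : Fin n → ↥(D.PiX ⊓ D.DeltaC)}
    (hfree : IsFreeProOn ↥(D.PiX ⊓ D.DeltaC) Set.univ gens) :
    ∀ g : ↥(D.PiX ⊓ D.DeltaC), IsOfFinOrder g → g = 1 :=
  haveI : CompactSpace ↥(D.PiX ⊓ D.DeltaC) :=
    isCompact_iff_compactSpace.mp D.isClosed_piX_inf_deltaC.isCompact
  hfree.torsionFree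

end PuncturedEllipticData

/-! ### §3. The closer of record with `hrank′` discharged and `hΔ`, `hΔ′` derived -/

namespace InitialThetaData

open scoped Pointwise
open Literature.AnabelianGeometry.AbsoluteAnabelian
open Literature.AnabelianGeometry.AbsoluteAnabelian.FundamentalExtension (CuspidalAlgorithm)
open Literature.AnabelianGeometry.AbsoluteAnabelian.AbsTopII (semiEllipticDoubleCoverSubgroups)

universe u u'

variable {F : Type u} {K : Type} {Fbar : Type} [Field F] [NumberField F] [Field K] [NumberField K]
  [Algebra F K] [Field Fbar] [Algebra F Fbar] [Algebra K Fbar]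
  {E : WeierstrassCurve F} [E.IsElliptic] {l : ℕ} {Pb : BadPlacePredicates K}
  (D : InitialThetaData F K Fbar E l Pb)
  {F' : Type u'} {K' : Type} [Field F'] [NumberField F'] [Field K'] [NumberField K'] [Algebra F' K']
  {Fbar' : Type} [Field Fbar'] [Algebra F' Fbar'] [Algebra K' Fbar']
  {E' : WeierstrassCurve F'} [E'.IsElliptic] {l' : ℕ} {Pb' : BadPlacePredicates K'}
  (D' : InitialThetaData F' K' Fbar' E' l' Pb')

/-- **[IUTchI] Cor. 1.2 between the `K`-level data of two initial Θ-data — closer of record p448270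
(`pe_characteristicNatureOfCoverings_viaX_of_laws`) with `hrank′` DISCHARGED and `hΔ`, `hΔ′` DERIVED from the
instance-shaped classical input «`Δ_X` free profinite on two generators» at the two data** (`hfree`, `hfree′`:
[SGA1 XIII 2.12] at the once-punctured elliptic curves `X_K`, `X_{K′}`; [AbsTopI] Lem. 4.5 (i) `IsFreeProOn`
vocabulary, F-0242 shape).  The printed claims `ArrowCoveringClaims` ×2 are derived from `CuspGalois` +
`ModLCuspLaws` (abc-iut-L5-t1 p448117) as in `layer5_held_cor12_v6`.  Remaining LAW binders: `hL L′ h0 h0′ htf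
huniq′ hext hextC hA hA′ hIH′` (11) + the two instance-shaped `hfree hfree′`; DATA `C C′ A`.
([IUTchI] Cor 1.2 p.39) [claim: Mochizuki2012, status: disputed] -/
theorem pe_characteristicNatureOfCoverings_viaX_of_freePro
    (C : D.geom.pe.CuspGalois) (C' : D'.geom.pe.CuspGalois)
    (hL : D.geom.pe.ModLCuspLaws) (L' : D'.geom.pe.ModLCuspLaws)
    {gens : Fin 2 → ↥(D.geom.pe.PiX ⊓ D.geom.pe.DeltaC)}
    (hfree : IsFreeProOn ↥(D.geom.pe.PiX ⊓ D.geom.pe.DeltaC) Set.univ gens)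
    {gens' : Fin 2 → ↥(D'.geom.pe.PiX ⊓ D'.geom.pe.DeltaC)}
    (hfree' : IsFreeProOn ↥(D'.geom.pe.PiX ⊓ D'.geom.pe.DeltaC) Set.univ gens')
    (h0 : ¬ D.geom.pe.inertia D.geom.pe.ε0 ≤ D.geom.pe.piXarrow)
    (h0' : ¬ D'.geom.pe.inertia D'.geom.pe.ε0 ≤ D'.geom.pe.piXarrow)
    (htf : IsMulTorsionFree ↥(D.geom.pe.PiX ⊓ D.geom.pe.DeltaC))
    (huniq' : ∀ J ∈ semiEllipticDoubleCoverSubgroups D'.geom.pe.E,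
      J ⊓ D'.geom.pe.DeltaC = D'.geom.pe.PiX ⊓ D'.geom.pe.DeltaC)
    (hext : ∀ φ : D.geom.pe.piXarrow ≃* D'.geom.pe.piXarrow, Continuous φ → Continuous φ.symm →
      ∃ Θ : D.geom.pe.PiC ≃ₜ* D'.geom.pe.PiC,
        ∀ x : D.geom.pe.piXarrow, Θ (x : D.geom.pe.PiC) = (φ x : D'.geom.pe.PiC))
    (hextC : ∀ ψ : D.geom.pe.piCarrow ≃* D'.geom.pe.piCarrow, Continuous ψ → Continuous ψ.symm →
      ∃ Θ : D.geom.pe.PiC ≃ₜ* D'.geom.pe.PiC,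
        ∀ x : D.geom.pe.piCarrow, Θ (x : D.geom.pe.PiC) = (ψ x : D'.geom.pe.PiC))
    (A : CuspidalAlgorithm.{0}) (hA : A.RecoversCusps D.geom.pe.extXbar C.cuspidalDataXbar)
    (hA' : A.RecoversCusps D'.geom.pe.extXbar C'.cuspidalDataXbar)
    (hIH' : ∀ x : D'.geom.pe.Cusp, D'.geom.pe.inertia x ≤
      (⁅D'.geom.pe.PiX ⊓ D'.geom.pe.DeltaC, D'.geom.pe.PiX ⊓ D'.geom.pe.DeltaC⁆ ⊔
        Subgroup.closure ((fun y : D'.geom.pe.PiC => y ^ D'.geom.pe.l) ''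
          (D'.geom.pe.PiX ⊓ D'.geom.pe.DeltaC : Set D'.geom.pe.PiC))).topologicalClosure) :
    D.geom.pe.CharacteristicNatureOfCoverings D'.geom.pe :=
  D.pe_characteristicNatureOfCoverings_viaX_of_laws D' (D.arrowCoveringClaims_pe_of_modLCuspLaws C hL)
    (D'.arrowCoveringClaims_pe_of_modLCuspLaws C' L') C C' h0 h0'
    (D.geom.pe.geomTFG_of_isFreeProOn hfree) (D'.geom.pe.geomTFG_of_isFreeProOn hfree')
    htf huniq' hext hextC A hA hA' L' hIH' (D'.geom.pe.relIndex_H_eq_sq_of_isFreeProOn hfree')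

end InitialThetaData

end Literature.IUT.HodgeTheaters
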